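import Mathlib.CategoryTheory.Conj
import Mathlib.CategoryTheory.Equivalence
import Mathlib.CategoryTheory.NatIso
import Mathlib.Algebra.Group.Subgroup.Pointwise
import Mathlib.Logic.Function.Basic

/-!
# Conjugation of a category by a system of automorphisms
([EtTh] Lemma 5.11, Remark 5.12.1, and the category-theoretic core of Corollary 5.12 (iii))

Source: S. Mochizuki, *The Étale Theta Function and its Frobenioid-theoretic Manifestations*,
Publ. RIMS 45 (2009) 227–349 (`MochizukiEtTh2009`), §5, printed pp. 338–341
(= PDF pp. 112–115 of `paper:doi-10-2977-prims-1234361159`).  Locators below give the printed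
page first and the PDF page of that render in parentheses.

Mochizuki's Lemma 5.11 ("Non-category-theoreticity of Particular Morphisms in an Abstract
Equivalence Class") is the following piece of "well-known general nonsense" (his words, p. 338):
given a category `E`, three *distinct* objects `G H I` and automorphisms `α_G, α_H, α_I`, there is a
self-equivalence `Ξ : E ⥤ E` which is the identity on objects, is isomorphic to the identity functor
via an isomorphism whose components are `α_G, α_H, α_I` at `G, H, I` and the identity elsewhere, and
which therefore sends `f : G ⟶ H` to `α_H ∘ f ∘ α_G⁻¹` and `g : G ⟶ G` to `α_G ∘ g ∘ α_G⁻¹`.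

We formalise (and PROVE) the construction in its natural generality — conjugation by an ARBITRARY
system of automorphisms `α_X : X ≅ X` (`conjFunctor α`, `conjFunctorIso α`, `conjEquivalence α`)
— and then specialise to the printed three-object system (`threePointSystem`, `lemma_5_11_*`).
The "In particular" clause of Corollary 5.12 (iii) (p. 340), which the paper obtains "immediately
from Lemma 5.11" once the three objects `A_N, B_N, B_{N'}` are known to be pairwise non-isomorphic
(Cor. 5.12 (i)), is proved here in the same abstract form (`cor_5_12_iii_core_*`); its
Frobenioid-theoretic instance is typed in `ConstantMultipleIndeterminacy.lean` of this directory.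
Remark 5.12.1 (p. 341: "for any `E ∈ Ob(E)`, `Aut_E(E)` has a natural group structure") is
Mathlib's group instance on `Aut E` (`remark_5_12_1`).

Design notes.
* Systems of automorphisms are typed `α : ∀ X, X ≅ X` (Mathlib's `Aut X` is by definition
  `X ≅ X`; we use the `Iso` form so that `simp` sees the `Iso` API).  Mathlib's group `Aut X`
  multiplies in `Function.comp` order: `(x * y).hom = y.hom ≫ x.hom`, `x⁻¹ = x.symm`.  Hence the
  printed `α_H ∘ f ∘ α_G⁻¹` is `(α G).inv ≫ f ≫ (α H).hom` in diagrammatic notation, and the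
  printed conjugate subgroup `κ⁻¹ · S · κ ⊆ Aut(J)` is `MulAut.conj κ⁻¹ • S`.
* "Distinct objects" is literal (`G ≠ H` as terms); non-isomorphic objects are distinct
  (`ne_of_isEmpty_iso`), which is how Corollary 5.12 (i) feeds Lemma 5.11.
* Nothing here is specific to Frobenioids; this file imports Mathlib only.
-/

namespace Literature.AnabelianGeometry.EtaleTheta

open CategoryTheory

universe v u

variable {C : Type u} [Category.{v} C]

/-- Conjugation of a category by a system of automorphisms `α_X : X ≅ X` (one for every object):
the functor that is the identity on objects and sends `f : X ⟶ Y` to `α_Y ∘ f ∘ α_X⁻¹`, i.e.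
`(α X).inv ≫ f ≫ (α Y).hom` in diagrammatic order.  This is the functor `Ξ` constructed in the
proof of [EtTh] Lemma 5.11 ("one may define an equivalence of categories … which restricts to the
identity on `Ob(E)` and maps `j ↦ j ∘ (α_G)⁻¹`, `j' ↦ α_G ∘ j'`, `j'' ↦ α_G ∘ j'' ∘ α_G⁻¹`,
`j''' ↦ j'''`"), for a general system `α`.
[cite: MochizukiEtTh2009, Lem 5.11 proof p.339 (PDF p.113)] -/
def conjFunctor (α : ∀ X : C, X ≅ X) : C ⥤ C where
  obj X := X
  map {X Y} f := (α X).inv ≫ f ≫ (α Y).hom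
  map_id X := by simp
  map_comp f g := by simp

/-- `Ξ` "restricts to the identity on `Ob(E)`". [cite: MochizukiEtTh2009, Lem 5.11 p.338 (PDF p.112)] -/
@[simp]
theorem conjFunctor_obj (α : ∀ X : C, X ≅ X) (X : C) : (conjFunctor α).obj X = X := rfl

/-- `Ξ` on morphisms: `f ↦ α_Y ∘ f ∘ α_X⁻¹`. [cite: MochizukiEtTh2009, Lem 5.11 p.339 (PDF p.113)] -/
@[simp]
theorem conjFunctor_map (α : ∀ X : C, X ≅ X) {X Y : C} (f : X ⟶ Y) :
    (conjFunctor α).map f = (α X).inv ≫ f ≫ (α Y).hom := rfl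

/-- The isomorphism `𝟭 ⟶ Ξ` "that maps `J ↦ α_J ∈ Aut_E(J)`": its component at `X` is `α_X`.
[cite: MochizukiEtTh2009, Lem 5.11 p.338–339 (PDF pp.112–113)] -/
def conjFunctorIso (α : ∀ X : C, X ≅ X) : 𝟭 C ≅ conjFunctor α :=
  NatIso.ofComponents (fun X => α X) (by intro X Y f; simp)

/-- Components of `𝟭 ≅ Ξ`: `α_X`. [cite: MochizukiEtTh2009, Lem 5.11 p.339 (PDF p.113)] -/
@[simp]
theorem conjFunctorIso_hom_app (α : ∀ X : C, X ≅ X) (X : C) :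
    (conjFunctorIso α).hom.app X = (α X).hom := rfl

/-- Components of the inverse `Ξ ≅ 𝟭`: `α_X⁻¹`. [cite: MochizukiEtTh2009, Lem 5.11 p.339 (PDF p.113)] -/
@[simp]
theorem conjFunctorIso_inv_app (α : ∀ X : C, X ≅ X) (X : C) :
    (conjFunctorIso α).inv.app X = (α X).inv := rfl

/-- Conjugating by `α` and then by the inverse system `α.symm` is the identity on morphisms.
[cite: MochizukiEtTh2009, Lem 5.11 proof p.339 (PDF p.113)] -/
@[simp]
theorem conjFunctor_symm_map_conjFunctor_map (α : ∀ X : C, X ≅ X) {X Y : C} (f : X ⟶ Y) :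
    (conjFunctor fun Z => (α Z).symm).map ((conjFunctor α).map f) = f := by
  simp

/-- `Ξ` is a self-equivalence of the category ("an equivalence of categories that is isomorphic to
the identity self-equivalence"); its quasi-inverse is conjugation by the inverse system, with
identity unit and counit.  [cite: MochizukiEtTh2009, Lem 5.11 p.338–339 (PDF pp.112–113)] -/
def conjEquivalence (α : ∀ X : C, X ≅ X) : C ≌ C where
  functor := conjFunctor α
  inverse := conjFunctor fun X => (α X).symm
  unitIso := NatIso.ofComponents (fun X => Iso.refl X) (by
    intro X Y f
    change f ≫ 𝟙 Y = 𝟙 X ≫ ((α X).symm.inv ≫ ((α X).inv ≫ f ≫ (α Y).hom) ≫ (α Y).symm.hom)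
    simp)
  counitIso := NatIso.ofComponents (fun X => Iso.refl X) (by
    intro X Y f
    change ((α X).inv ≫ ((α X).symm.inv ≫ f ≫ (α Y).symm.hom) ≫ (α Y).hom) ≫ 𝟙 Y = 𝟙 X ≫ f
    simp)
  functor_unitIso_comp X := by
    change ((α X).inv ≫ 𝟙 X ≫ (α X).hom) ≫ 𝟙 X = 𝟙 X
    simp

/-- `Ξ = conjFunctor α` is an equivalence of categories.
[cite: MochizukiEtTh2009, Lem 5.11 p.338 (PDF p.112)] -/
instance conjFunctor_isEquivalence (α : ∀ X : C, X ≅ X) : (conjFunctor α).IsEquivalence :=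
  (conjEquivalence α).isEquivalence_functor

/-- On automorphism groups `Ξ` acts by conjugation by `α_J`: `Ξ.mapAut J = Iso.conjAut (α J)`,
i.e. `g ↦ α_J ∘ g ∘ α_J⁻¹`.  [cite: MochizukiEtTh2009, Lem 5.11 p.339 (PDF p.113)] -/
theorem conjFunctor_mapAut_apply (α : ∀ X : C, X ≅ X) (J : C) (g : Aut J) :
    (conjFunctor α).mapAut J g = (α J).conjAut g := by
  apply Aut.ext
  rw [Iso.conjAut_hom, Iso.conj_apply]
  rfl

/-- Conjugation `Iso.conjAut κ⁻¹` is, in the group `Aut J` (composition order), the inner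
automorphism `g ↦ κ⁻¹ * g * κ` — the printed "`κ⁻¹ · (−) · κ`".
[cite: MochizukiEtTh2009, Cor 5.12 (iii) p.340 (PDF p.114)] -/
theorem conjAut_inv_eq_conj {J : C} (κ g : Aut J) :
    Iso.conjAut (κ⁻¹ : Aut J) g = κ⁻¹ * g * κ := by
  apply Aut.ext
  rw [Iso.conjAut_hom, Iso.conj_apply, Aut.Aut_mul_def, Aut.Aut_mul_def, Aut.Aut_inv_def]
  simp

/-- `Iso.conjAut κ⁻¹`, as a monoid endomorphism of `Aut J`, is `MulAut.conj κ⁻¹`.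
[cite: MochizukiEtTh2009, Cor 5.12 (iii) p.340 (PDF p.114)] -/
theorem conjAut_inv_toMonoidHom {J : C} (κ : Aut J) :
    (Iso.conjAut (κ⁻¹ : Aut J)).toMonoidHom = (MulAut.conj κ⁻¹).toMonoidHom := by
  ext g : 1
  change Iso.conjAut (κ⁻¹ : Aut J) g = MulAut.conj κ⁻¹ g
  rw [conjAut_inv_eq_conj, MulAut.conj_apply, inv_inv]

open scoped Pointwise in
/-- Hence `Ξ` (for a system with `α_J = κ⁻¹`) maps a subgroup `S ⊆ Aut_E(J)` to the conjugate
subgroup `κ⁻¹ · S · κ`.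
[cite: MochizukiEtTh2009, Lem 5.11 p.339 (PDF p.113); Cor 5.12 (iii) p.340 (PDF p.114)] -/
theorem conjFunctor_map_subgroup (α : ∀ X : C, X ≅ X) (J : C) (κ : Aut J)
    (hκ : α J = ((κ⁻¹ : Aut J) : J ≅ J)) (S : Subgroup (Aut J)) :
    S.map ((conjFunctor α).mapAut J) = MulAut.conj κ⁻¹ • S := by
  have h : (conjFunctor α).mapAut J = (MulAut.conj κ⁻¹).toMonoidHom := by
    rw [← conjAut_inv_toMonoidHom]
    ext g : 1
    rw [conjFunctor_mapAut_apply, hκ]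
    rfl
  rw [h]
  rfl

/-- [EtTh] Remark 5.12.1: "Let `E` be a category. Then for any `E ∈ Ob(E)`, `Aut_E(E)` has a
natural group structure."  In Mathlib this is the group instance on `Aut E`; we record the remark
as that (definitionally equal) term.  The remainder of Remark 5.12.1 (temperoids represent the
*topological* group structure via "numerous objects corresponding to the various open subgroups"
rather than via a single universal covering object) is expository and has no formal content here.
[cite: MochizukiEtTh2009, Rmk 5.12.1 p.341 (PDF p.115)] -/
@[reducible] def remark_5_12_1 (E : C) : Group (Aut E) := inferInstance

/-- Non-isomorphic objects are distinct.  (This is how [EtTh] Cor. 5.12 (i) — "the isomorphism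
classes of `A_N, B_N, B_{N'}` are distinct" — supplies the distinctness hypothesis of Lemma 5.11
in the proof of Cor. 5.12 (iii), p. 341: "in light of assertion (i), assertion (iii) follows
immediately from Lemma 5.11".)
[cite: MochizukiEtTh2009, Cor 5.12 proof p.341 (PDF p.115)] -/
theorem ne_of_isEmpty_iso {X Y : C} (h : IsEmpty (X ≅ Y)) : X ≠ Y := by
  rintro rfl
  exact h.elim (Iso.refl X)

section ThreePoint

variable (G H I : C) (αG : G ≅ G) (αH : H ≅ H) (αI : I ≅ I)

/-- The system of automorphisms of [EtTh] Lemma 5.11: `α_G, α_H, α_I` at the three given objects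
and `id_J` at every other object `J` ("`J ↦ id_J ∈ Aut_E(J)` … for all `J ∈ Ob(E)` such that
`J ≠ G, H, I`").  Defined by successive `Function.update` (classical decidability of equality of
objects); when the three objects are distinct the values at `G, H, I` are the prescribed ones
(`threePointSystem_G/_H/_I`).
[cite: MochizukiEtTh2009, Lem 5.11 p.338–339 (PDF pp.112–113)] -/
noncomputable def threePointSystem : ∀ J : C, J ≅ J := by
  classical
  exact Function.update (Function.update (Function.update (fun J => Iso.refl J) I αI) H αH) G αG

/-- Value of the three-point system at `G`. [cite: MochizukiEtTh2009, Lem 5.11 p.339 (PDF p.113)] -/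
@[simp]
theorem threePointSystem_G : threePointSystem G H I αG αH αI G = αG := by
  classical
  simp [threePointSystem]

/-- Value at `H` (needs `H ≠ G`). [cite: MochizukiEtTh2009, Lem 5.11 p.339 (PDF p.113)] -/
theorem threePointSystem_H (hHG : H ≠ G) : threePointSystem G H I αG αH αI H = αH := by
  classical
  simp [threePointSystem, Function.update_of_ne hHG]

/-- Value at `I` (needs `I ≠ G`, `I ≠ H`). [cite: MochizukiEtTh2009, Lem 5.11 p.339 (PDF p.113)] -/
theorem threePointSystem_I (hIG : I ≠ G) (hIH : I ≠ H) :
    threePointSystem G H I αG αH αI I = αI := by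
  classical
  simp [threePointSystem, Function.update_of_ne hIG, Function.update_of_ne hIH]

/-- Value at any other object `J ≠ G, H, I` is the identity automorphism.
[cite: MochizukiEtTh2009, Lem 5.11 p.339 (PDF p.113)] -/
theorem threePointSystem_other {J : C} (hJG : J ≠ G) (hJH : J ≠ H) (hJI : J ≠ I) :
    threePointSystem G H I αG αH αI J = Iso.refl J := by
  classical
  simp [threePointSystem, Function.update_of_ne hJG, Function.update_of_ne hJH,
    Function.update_of_ne hJI]

/-- [EtTh] Lemma 5.11, the self-equivalence: `Ξ := conjFunctor (threePointSystem …)` "induces the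
identity on `Ob(E)`".  [cite: MochizukiEtTh2009, Lem 5.11 p.338 (PDF p.112)] -/
theorem lemma_5_11_obj (J : C) : (conjFunctor (threePointSystem G H I αG αH αI)).obj J = J := rfl

/-- [EtTh] Lemma 5.11: the isomorphism `𝟭 ≅ Ξ` has component `α_G` at `G`.
[cite: MochizukiEtTh2009, Lem 5.11 p.339 (PDF p.113)] -/
theorem lemma_5_11_iso_app_G :
    (conjFunctorIso (threePointSystem G H I αG αH αI)).hom.app G = αG.hom := by
  simp

/-- [EtTh] Lemma 5.11: component `α_H` at `H` (for `H ≠ G`).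
[cite: MochizukiEtTh2009, Lem 5.11 p.339 (PDF p.113)] -/
theorem lemma_5_11_iso_app_H (hHG : H ≠ G) :
    (conjFunctorIso (threePointSystem G H I αG αH αI)).hom.app H = αH.hom := by
  simp [threePointSystem_H G H I αG αH αI hHG]

/-- [EtTh] Lemma 5.11: component `α_I` at `I` (for `I ≠ G, H`).
[cite: MochizukiEtTh2009, Lem 5.11 p.339 (PDF p.113)] -/
theorem lemma_5_11_iso_app_I (hIG : I ≠ G) (hIH : I ≠ H) :
    (conjFunctorIso (threePointSystem G H I αG αH αI)).hom.app I = αI.hom := by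
  simp [threePointSystem_I G H I αG αH αI hIG hIH]

/-- [EtTh] Lemma 5.11: component `id_J` at every `J ≠ G, H, I`.
[cite: MochizukiEtTh2009, Lem 5.11 p.339 (PDF p.113)] -/
theorem lemma_5_11_iso_app_other {J : C} (hJG : J ≠ G) (hJH : J ≠ H) (hJI : J ≠ I) :
    (conjFunctorIso (threePointSystem G H I αG αH αI)).hom.app J = 𝟙 J := by
  simp [threePointSystem_other G H I αG αH αI hJG hJH hJI]

/-- [EtTh] Lemma 5.11, "In particular, `Ξ` maps `f ↦ α_H ∘ f ∘ α_G⁻¹`" for `f : G → H`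
(`G ≠ H`).  [cite: MochizukiEtTh2009, Lem 5.11 p.339 (PDF p.113)] -/
theorem lemma_5_11_map_f (hGH : G ≠ H) (f : G ⟶ H) :
    (conjFunctor (threePointSystem G H I αG αH αI)).map f = αG.inv ≫ f ≫ αH.hom := by
  simp [threePointSystem_H G H I αG αH αI (Ne.symm hGH)]

/-- [EtTh] Lemma 5.11, "… `g ↦ α_G ∘ g ∘ α_G⁻¹`" for `g : G → G`.
[cite: MochizukiEtTh2009, Lem 5.11 p.339 (PDF p.113)] -/
theorem lemma_5_11_map_g (g : G ⟶ G) :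
    (conjFunctor (threePointSystem G H I αG αH αI)).map g = αG.inv ≫ g ≫ αG.hom := by
  simp

end ThreePoint

section Cor512Core

/-! ### The category-theoretic core of [EtTh] Corollary 5.12 (iii)

In Cor. 5.12 (iii) the three objects are `A_N, B_N, B_{N'}` of the tempered Frobenioid `C`
(pairwise non-isomorphic by Cor. 5.12 (i)), the automorphisms are `κ_A⁻¹, κ_B⁻¹, (κ')⁻¹`, and the
morphisms conjugated are `s^⊓_N, s^⊔_N : A_N → B_N` and `ζ : B_{N'} → B_N`.  We prove the displayed
formulae for an abstract category; the restriction of `κ_A, κ_B, κ'` to the subgroups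
`(O_K^×)^{1/N}|_A, (O_K^×)^{1/N}, (O_K^×)^*` plays no role in the existence statement. -/

variable {A B B' : C} (κA : Aut A) (κB : Aut B) (κ' : Aut B')

/-- The system of automorphisms of [EtTh] Cor. 5.12 (iii): `A_N ↦ κ_A⁻¹`, `B_N ↦ κ_B⁻¹`,
`B_{N'} ↦ (κ')⁻¹`, every other object `↦ id`.
[cite: MochizukiEtTh2009, Cor 5.12 (iii) p.340 (PDF p.114)] -/
noncomputable abbrev cor512Sys (A B B' : C) (κA : Aut A) (κB : Aut B) (κ' : Aut B') :
    ∀ J : C, J ≅ J :=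
  threePointSystem A B B' (κA⁻¹ : Aut A) (κB⁻¹ : Aut B) (κ'⁻¹ : Aut B')

/-- The self-equivalence `Ξ : C ⥤ C` of [EtTh] Cor. 5.12 (iii): conjugation by the system
`A_N ↦ κ_A⁻¹`, `B_N ↦ κ_B⁻¹`, `B_{N'} ↦ (κ')⁻¹`, all other objects `↦ id`.
[cite: MochizukiEtTh2009, Cor 5.12 (iii) p.340 (PDF p.114)] -/
noncomputable abbrev cor512Xi (A B B' : C) (κA : Aut A) (κB : Aut B) (κ' : Aut B') : C ⥤ C :=
  conjFunctor (cor512Sys A B B' κA κB κ')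

/-- Cor. 5.12 (iii): the isomorphism `𝟭 ≅ Ξ` "maps `A_N ↦ κ_A⁻¹ ∈ Aut_C(A_N)`".
[cite: MochizukiEtTh2009, Cor 5.12 (iii) p.340 (PDF p.114)] -/
theorem cor_5_12_iii_core_iso_app_A :
    (conjFunctorIso (cor512Sys A B B' κA κB κ')).hom.app A = κA.inv := by
  rw [lemma_5_11_iso_app_G, Aut.Aut_inv_def, Iso.symm_hom]

/-- Cor. 5.12 (iii): "`B_N ↦ κ_B⁻¹ ∈ Aut_C(B_N)`" (given `A_N ≠ B_N`).
[cite: MochizukiEtTh2009, Cor 5.12 (iii) p.340 (PDF p.114)] -/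
theorem cor_5_12_iii_core_iso_app_B (hAB : A ≠ B) :
    (conjFunctorIso (cor512Sys A B B' κA κB κ')).hom.app B = κB.inv := by
  rw [lemma_5_11_iso_app_H A B B' _ _ _ (Ne.symm hAB), Aut.Aut_inv_def, Iso.symm_hom]

/-- Cor. 5.12 (iii): "`B_{N'} ↦ (κ')⁻¹ ∈ Aut_C(B_{N'})`" (given pairwise distinctness).
[cite: MochizukiEtTh2009, Cor 5.12 (iii) p.340 (PDF p.114)] -/
theorem cor_5_12_iii_core_iso_app_B' (hAB' : A ≠ B') (hBB' : B ≠ B') :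
    (conjFunctorIso (cor512Sys A B B' κA κB κ')).hom.app B' = κ'.inv := by
  rw [lemma_5_11_iso_app_I A B B' _ _ _ (Ne.symm hAB') (Ne.symm hBB'), Aut.Aut_inv_def,
    Iso.symm_hom]

/-- Cor. 5.12 (iii), "In particular, `Ξ` maps `s^⊓_N ↦ κ_B⁻¹ ∘ s^⊓_N ∘ κ_A`;
`s^⊔_N ↦ κ_B⁻¹ ∘ s^⊔_N ∘ κ_A`": for ANY `s : A_N → B_N`, provided `A_N ≠ B_N`.
[cite: MochizukiEtTh2009, Cor 5.12 (iii) p.340 (PDF p.114)] -/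
theorem cor_5_12_iii_core_map_s (hAB : A ≠ B) (s : A ⟶ B) :
    (cor512Xi A B B' κA κB κ').map s = κA.hom ≫ s ≫ κB.inv := by
  rw [lemma_5_11_map_f A B B' (κA⁻¹ : Aut A) (κB⁻¹ : Aut B) (κ'⁻¹ : Aut B') hAB s,
    Aut.Aut_inv_def, Aut.Aut_inv_def]
  simp

/-- Cor. 5.12 (iii), "`ζ ↦ κ_B⁻¹ ∘ ζ ∘ κ'`" for `ζ : B_{N'} → B_N`, provided the three objects are
pairwise distinct.  [cite: MochizukiEtTh2009, Cor 5.12 (iii) p.340 (PDF p.114)] -/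
theorem cor_5_12_iii_core_map_zeta (hAB : A ≠ B) (hAB' : A ≠ B') (hBB' : B ≠ B')
    (ζ : B' ⟶ B) :
    (cor512Xi A B B' κA κB κ').map ζ = κ'.hom ≫ ζ ≫ κB.inv := by
  dsimp only [cor512Xi, cor512Sys]
  rw [conjFunctor_map, threePointSystem_H A B B' (κA⁻¹ : Aut A) (κB⁻¹ : Aut B) (κ'⁻¹ : Aut B')
    (Ne.symm hAB), threePointSystem_I A B B' (κA⁻¹ : Aut A) (κB⁻¹ : Aut B) (κ'⁻¹ : Aut B')
    (Ne.symm hAB') (Ne.symm hBB')]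
  simp only [Aut.Aut_inv_def, Iso.symm_inv, Iso.symm_hom]

open scoped Pointwise in
/-- Cor. 5.12 (iii), the effect on subgroups of `Aut_C(A_N)`:
"`Im(s^trv_N) (⊆ Aut_C(A_N)) ↦ κ_A⁻¹ · Im(s^trv_N) · κ_A`" — for ANY subgroup `S ⊆ Aut(A_N)`.
[cite: MochizukiEtTh2009, Cor 5.12 (iii) p.340 (PDF p.114)] -/
theorem cor_5_12_iii_core_subgroup_A (S : Subgroup (Aut A)) :
    S.map ((cor512Xi A B B' κA κB κ').mapAut A) = MulAut.conj κA⁻¹ • S :=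
  conjFunctor_map_subgroup _ A κA (threePointSystem_G A B B' _ _ _) S

open scoped Pointwise in
/-- Cor. 5.12 (iii), the effect on subgroups of `Aut_C(B_N)`:
"`Im(s^⊓-gp_N) ↦ κ_B⁻¹ · Im(s^⊓-gp_N) · κ_B`, `Im(s^⊔-gp_N) ↦ κ_B⁻¹ · Im(s^⊔-gp_N) · κ_B`" — for ANY
subgroup `S ⊆ Aut(B_N)`, provided `A_N ≠ B_N`.
[cite: MochizukiEtTh2009, Cor 5.12 (iii) p.340 (PDF p.114)] -/
theorem cor_5_12_iii_core_subgroup_B (hAB : A ≠ B) (S : Subgroup (Aut B)) :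
    S.map ((cor512Xi A B B' κA κB κ').mapAut B) = MulAut.conj κB⁻¹ • S :=
  conjFunctor_map_subgroup _ B κB (threePointSystem_H A B B' _ _ _ (Ne.symm hAB)) S

end Cor512Core

end Literature.AnabelianGeometry.EtaleTheta
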